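import Mathlib
import Summits.Ventures.PercRepro2.Defs
import Summits.Ventures.PercRepro2.Independence
import Summits.Ventures.PercRepro2.Harris
import Summits.Ventures.PercRepro2.Graph
import Summits.Ventures.PercRepro2.Exploration
import Summits.Ventures.PercRepro2.Events
import Summits.Ventures.PercRepro2.RBDefs

/-!
# Row 2′RB certifies the `a₃`-free piece `T1` of (HMF) (blind cell PercRepro2, typer-1; mine-a g3
MINE-A.md §18 "RELATION TO THE CRUX: (HMF) = T1 + T2 − T3 with T1 := Cov_π(β, d) ≥ 0 BY (RB-BHK)",
INBOX 15:26:16Z "T1 ≥ 0 is a corollary of 2′RB")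

With `β = bL̂ − bĤ`, `d = oL̂ − oĤ` (the conditional probabilities given the cluster of the third
vertex `w`, `L` = the cluster of `s`, `H` = the cluster of `t`),
`T1 = Cov_π(β, d) = [Cov_π(bL̂, oL̂) + Cov_π(bĤ, oĤ)] − [Cov_π(bL̂, oĤ) + Cov_π(bĤ, oL̂)]`
(`T1`), and the four instances of row 2′RB at `(s, t)` and `(t, s)` sign the four terms
(`covPi_comm_roots`: the mirrors live in the same frame since `Q` is symmetric). Hence

* **`T1_nonneg_of_RB`**: `0 ≤ T1` from the four instance-level rows (with `P(Q) > 0`);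
* **`T1_nonneg_of_RB_all`**: `0 ≤ T1` on every graph from `RB_all`.

(The remaining open content of (HMF) is `T2 − T3 ≥ −T1`, MINE-A.md §18.)
-/

namespace Summit.Ventures.PercRepro2

namespace RB

open scoped Classical

variable {V : Type*} {E : Type*} [Fintype E] [DecidableEq E] [Fintype V] [DecidableEq V]
  {R : Type*} [Field R] [LinearOrder R] [IsStrictOrderedRing R]

variable (p : E → R) (ends : E → Sym2 V) (o b s t w : V)

omit [DecidableEq V] [LinearOrder R] [IsStrictOrderedRing R] in
/-- `Cov_π` is the same in the two orientations of the roots (`Q` is symmetric). -/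
lemma covPi_comm_roots (X Y : Set (Config E)) :
    covPi p ends t s w X Y = covPi p ends s t w X Y := by
  simp only [covPi, piExpect, piLaw, condProb, Qst_comm]

/-- `T1 = Cov_π(bL̂ − bĤ, oL̂ − oĤ)` expanded: `[Cov_π(bL̂, oL̂) + Cov_π(bĤ, oĤ)] − [Cov_π(bL̂, oĤ) + Cov_π(bĤ, oL̂)]`
(mine-a §18), all four in the frame `Q = {s ↮ t}`, third vertex `w`. -/
noncomputable def T1 : R :=
  covPi p ends s t w (connEvent ends b s) (connEvent ends o s) +
      covPi p ends s t w (connEvent ends b t) (connEvent ends o t) -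
    covPi p ends s t w (connEvent ends b s) (connEvent ends o t) -
      covPi p ends s t w (connEvent ends b t) (connEvent ends o s)

variable {p}

omit [DecidableEq V] in
/-- **`T1 ≥ 0` from row 2′RB** at `(s, t)` and at `(t, s)` (both (RB-same) and (RB-cross)),
for `P(Q) > 0`. -/
theorem T1_nonneg_of_RB (hp : IsProbVec p) (hQ : 0 < prob p (Qst ends s t))
    (hsame : RBsame p ends o b s t w) (hsame' : RBsame p ends o b t s w)
    (hcross : RBcross p ends o b s t w) (hcross' : RBcross p ends o b t s w) :
    0 ≤ T1 p ends o b s t w := by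
  have hQ' : 0 < prob p (Qst ends t s) := by rwa [Qst_comm]
  have h1 := (RBsame_iff_covPi ends s t w hp hQ o b).1 hsame
  have h2 := (RBsame_iff_covPi ends t s w hp hQ' o b).1 hsame'
  have h3 := (RBcross_iff_covPi ends s t w hp hQ o b).1 hcross
  have h4 := (RBcross_iff_covPi ends t s w hp hQ' o b).1 hcross'
  rw [covPi_comm_roots] at h2 h4
  unfold T1
  linarith

end RB

namespace RB

variable {R : Type*} [Field R] [LinearOrder R] [IsStrictOrderedRing R]

open scoped Classical

/-- **`T1 ≥ 0` on every graph from `RB_all`** (for `s ≠ t` and `P(Q) > 0`). -/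
theorem T1_nonneg_of_RB_all (hall : RB_all R) {V E : Type} [Fintype V] [DecidableEq V]
    [Fintype E] [DecidableEq E] (ends : E → Sym2 V) {p : E → R} (hp : IsProbVec p)
    (o b s t w : V) (hst : s ≠ t) (hQ : 0 < prob p (Qst ends s t)) :
    0 ≤ T1 p ends o b s t w :=
  T1_nonneg_of_RB ends o b s t w hp hQ (hall V E ends p hp o b s t w hst).2
    (hall V E ends p hp o b t s w hst.symm).2 (hall V E ends p hp o b s t w hst).1
    (hall V E ends p hp o b t s w hst.symm).1

end RB

end Summit.Ventures.PercRepro2
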